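import Literature.Probability.Percolation.ArmSeparationThinRing
import Literature.Probability.Percolation.ArmSeparationNonvacuity
import HarnessLib

/-!
# Landing a hooked arm: ring arc, exit run and target free space

Topic: Probability / Percolation; family `crit-perc`. A brick of the discharge of
`Literature.Probability.Percolation.Nolin2008_twoArm_separation` (Nolin 2008, Thm. 11
[arXiv 0711.4948: Thm. 10], `j = 2`, `σ = BW`; `ArmSeparation.lean`), landing step of the internal
extremities (Nolin 2008, Prop. 12 (iii)–(i) [arXiv Prop. 11]: "once well-separated, the arms can
easily be extended", RSW corridors). This file is the **deterministic gluing** of the landing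
corridor, downstream of the hook (`arm_to_entry`, `ArmSeparationSpoke.lean`): an open arm of `χ`
attached to an outer free space at `uo` and already joined to the start `X E` of a crossing of
the first tube `E` of a chain of crossed tubes `E :: L` (an arc of the thin ring of radius `r`,
`ArmSeparationThinRing.lean`) that contains a run `V_{j₀}, …, V_{j₀+d}` of pieces of the side
`x₀ = r` spanning the rows `[t, t + n/64]`, together with a horizontal crossing of the approach
tube `[n - n/8 + 1, r + 2e] × [t, t + n/64]` and a vertical crossing of the thinned target free
space `[n - n/8 + 1, n - 1] × [t - n/64, t + n/64]` at a landing row `t` of `∂Λ_n`, produces a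
fenced open arm landing on the right side of `Λ_n`: `χ ∈ sepOpenArm n N`.

* `tgtRow n b` — the two target rows `-(n/4 + n/16)`, `-(n - n/4 - n/16)` (both in the landing
  zone: `mk_tgtRow_mem_sepLanding`; far apart);
* `tgtH n t W`, `tgtV n t` — the approach tube and the thinned target free space (events);
  `tgtHStrip_subset_sepJoinRegion`, `tgtVStrip_subset_sepInnerFence`;
* `landing_glue` — the gluing (crossing lemma `exists_mem_of_cross` three times, chains read with
  prescribed crossings `Tube.chain_paths'`).

## References

* P. Nolin, *Near-critical percolation in two dimensions*, Electron. J. Probab. 13 (2008), §4.2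
  Def. 6–8, §4.3 Prop. 12 [arXiv 0711.4948: Def. 6–8, Prop. 11]. [Nolin2008]
* H. Kesten, *Scaling relations for 2D-percolation*, Comm. Math. Phys. 109 (1987), Lemma 2. [Kesten1987]
-/

noncomputable section

open Set

namespace Literature.Probability.Percolation

open LatticeModels Tube

/-! ### Targets -/

/-- **The two target rows** on the right side of `∂Λ_n`: `-(n/4 + n/16)` (`b = true`) and
`-(n - n/4 - n/16)` (`b = false`). [cite: Nolin2008, §4.2 Def. 8 (arXiv 0711.4948)] -/
def tgtRow (n : ℕ) (b : Bool) : ℤ := bif b then -((n / 4 : ℕ) : ℤ) - (n / 16 : ℕ) else -(n : ℤ) + (n / 4 : ℕ) + (n / 16 : ℕ)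

/-- Both target sites `(n, tgtRow n b)` lie in the landing zone of `∂Λ_n` (`16 ≤ n`). [cite: Nolin2008, §4.2 Def. 8 (arXiv 0711.4948)] -/
theorem mk_tgtRow_mem_sepLanding {n : ℕ} (hn : 16 ≤ n) (b : Bool) : (![(n : ℤ), tgtRow n b] : Site 2) ∈ sepLanding n := by
  rw [mem_sepLanding, site_mk_apply_zero, site_mk_apply_one]
  refine ⟨rfl, ?_, ?_⟩ <;> cases b <;> simp only [tgtRow, cond_true, cond_false] <;> omega

/-- The two target rows are at least `n/4` apart: `tgtRow n false + n/4 ≤ tgtRow n true` (`16 ≤ n`). [folklore] -/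
theorem tgtRow_false_add_le {n : ℕ} (hn : 16 ≤ n) : tgtRow n false + (n / 4 : ℕ) ≤ tgtRow n true := by
  simp only [tgtRow, cond_true, cond_false]; omega

/-- The target rows lie in `[-n + n/4, -n/4]`. [folklore] -/
theorem tgtRow_mem {n : ℕ} (b : Bool) : -(n : ℤ) + (n / 4 : ℕ) ≤ tgtRow n b ∧ tgtRow n b ≤ -((n / 4 : ℕ) : ℤ) := by
  cases b <;> simp only [tgtRow, cond_true, cond_false] <;> omega

/-- **The approach tube** `[n - n/8 + 1, n - n/8 + 1 + W] × [t, t + n/64]`, crossed horizontally. [cite: Nolin2008, §4.3 Prop. 12 (proof) (arXiv 0711.4948: Prop. 11)] -/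
def tgtH (n : ℕ) (t : ℤ) (W : ℕ) : Set (SiteConfig (Site 2)) := triHCross ((n : ℤ) - (n / 8 : ℕ) + 1) t W (n / 64)

/-- **The thinned target free space** `[n - n/8 + 1, n - 1] × [t - n/64, t + n/64]`, crossed
vertically. [cite: Nolin2008, §4.2 Def. 6–7 (arXiv 0711.4948)] -/
def tgtV (n : ℕ) (t : ℤ) : Set (SiteConfig (Site 2)) :=
  triVCross ((n : ℤ) - (n / 8 : ℕ) + 1) (t - (n / 64 : ℕ)) (n / 8 - 2) (2 * (n / 64))

/-- The thinned target free space lies inside the inner free space at `(n, t)` (`16 ≤ n`). [cite: Nolin2008, §4.2 Def. 6–7 (arXiv 0711.4948)] -/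
theorem tgtVStrip_subset_sepInnerFence {n : ℕ} (hn : 16 ≤ n) (t : ℤ) :
    triStrip ((n : ℤ) - (n / 8 : ℕ) + 1) (t - (n / 64 : ℕ)) (n / 8 - 2) (2 * (n / 64)) ⊆ sepInnerFence n ![(n : ℤ), t] := by
  intro v hv
  rw [mem_triStrip] at hv
  rw [mem_sepInnerFence, site_mk_apply_one]
  have h8 : ((n / 8 - 2 : ℕ) : ℤ) = (n / 8 : ℕ) - 2 := by omega
  push_cast at hv
  omega

/-- The approach tube lies in the arm region `sepJoinRegion n N zo (n, t)`: its sites inside `Λ̊_n`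
are in the attaching ball `S̊_{n/8}(n, t)`, the others in the annulus (`64 ≤ n`,
`n ≤ N`, `n - n/8 + 1 + W ≤ N`, `-n + n/4 ≤ t ≤ -n/4`). [cite: Nolin2008, §4.2 Def. 6–7 (arXiv 0711.4948)] -/
theorem tgtHStrip_subset_sepJoinRegion {n N W : ℕ} (hn : 64 ≤ n) (hnN : n ≤ N) (hW : (n : ℤ) - (n / 8 : ℕ) + 1 + W ≤ N)
    {t : ℤ} (ht : -(n : ℤ) + (n / 4 : ℕ) ≤ t ∧ t ≤ -((n / 4 : ℕ) : ℤ)) (zo : Site 2) :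
    triStrip ((n : ℤ) - (n / 8 : ℕ) + 1) t W (n / 64) ⊆ sepJoinRegion n N zo ![(n : ℤ), t] := by
  intro v hv
  rw [mem_triStrip] at hv
  have hnN' : (n : ℤ) ≤ N := by exact_mod_cast hnN
  rcases le_or_gt (n : ℤ) (v 0) with h0 | h0
  · refine Or.inl (Or.inl ⟨le_triNorm_iff_lin.2 (Or.inl h0), triNorm_le_iff_lin.2 ?_⟩)
    omega
  · refine Or.inr ?_
    rw [mem_triOpenBall, triNorm_lt_iff_lin]
    simp only [Pi.sub_apply, site_mk_apply_zero, site_mk_apply_one]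
    omega

/-! ### The gluing -/

/-- A nonempty chunked vertical side, as head and tail. [folklore] -/
theorem vchunks_eq_cons (x y₀ : ℤ) (e s j d : ℕ) : ∃ L₀ : List Tube, vchunks x y₀ e s j (d + 1) = vPiece x y₀ e s j :: L₀ := by
  cases d with
  | zero => exact ⟨[], rfl⟩
  | succ d => exact ⟨_, rfl⟩

/-- **Landing glue.** In a configuration `χ`, let an outer free space at `zo ∈ sepLanding N` be
crossed through `uo`, and let `uo` be joined (inside a region `R₁` of the arm region) to the start
`X Te` of the crossing of some tube `Te` of a chain of tubes `E :: L`, all crossed by `χ` with the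
crossings `(X T, Y T)`, all inside the annulus `{n ≤ |v| ≤ N}`, and containing the run
`V_{j₀}, …, V_{j₀+d}` of pieces of the side `x₀ = r` whose starts span the rows `[t, t + n/64]`.
If moreover the approach tube `[n - n/8 + 1, r + 2e] × [t, t + n/64]` is crossed horizontally and
the thinned target free space at the landing row `t` vertically, then `χ ∈ sepOpenArm n N`:
the target crossing meets the approach crossing at the new attaching site, the approach crossing
meets the run (read with the prescribed crossings, `chain_paths'`), and the run's first start is
joined to `X Te` along the chain. [cite: Nolin2008, §4.3 Prop. 12 (proof) (arXiv 0711.4948: Prop. 11)] -/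
theorem landing_glue {n N : ℕ} {χ : SiteConfig (Site 2)} {zo uo : Site 2} (hzo : zo ∈ sepLanding N)
    (hOut : OpenVCrossThrough (sepOuterFence N zo) (zo 1 - (N / 64 : ℕ)) (zo 1 + (N / 64 : ℕ)) χ uo)
    {t : ℤ} (ht : (![(n : ℤ), t] : Site 2) ∈ sepLanding n)
    {E : Tube} {L : List Tube} (hch : List.IsChain Crosses (E :: L)) {X Y : Tube → Site 2}
    (hXY : ∀ T ∈ E :: L, T.IsCrossing χ (X T) (Y T)) (hLreg : ∀ T ∈ E :: L, T.box ⊆ triAnnulusSet n N)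
    {R₁ : Set (Site 2)} (hR₁ : R₁ ⊆ sepJoinRegion n N zo ![(n : ℤ), t]) {Te : Tube} (hTe : Te ∈ E :: L)
    (P₁ : PathIn triGraph (R₁ ∩ χ) uo (X Te)) {r e s j₀ d : ℕ} (hSL : ∀ T ∈ vchunks r (-(r : ℤ)) e s j₀ (d + 1), T ∈ E :: L)
    (hlo : -(r : ℤ) + j₀ * s - e ≤ t) (hhi : t + (n / 64 : ℕ) ≤ -(r : ℤ) + (j₀ + d) * s - e)
    (hre : (n : ℤ) ≤ (r : ℤ) - e) {W : ℕ} (hW : (n : ℤ) - (n / 8 : ℕ) + 1 + W = r + 2 * e)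
    (hH : χ ∈ tgtH n t W) (hV : χ ∈ tgtV n t) (hn : 64 ≤ n) (hrN : (r : ℤ) + 2 * e ≤ N) :
    χ ∈ sepOpenArm n N := by
  have htr := (mem_sepLanding.1 ht)
  rw [site_mk_apply_zero, site_mk_apply_one] at htr
  have h8 : ((n / 8 - 2 : ℕ) : ℤ) = (n / 8 : ℕ) - 2 := by omega
  -- (1) the target free space and the approach tube
  obtain ⟨bb, tt, hbb, htt, PF⟩ := hV
  obtain ⟨SF, hSF, PF', TF⟩ := PF.exists_support
  obtain ⟨hl, hr, hhl, hhr, PH⟩ := hH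
  obtain ⟨SH, hSH, PH', TH⟩ := PH.exists_support
  have hSFb : ∀ z ∈ SF, (n : ℤ) - (n / 8 : ℕ) + 1 ≤ z 0 ∧ z 0 ≤ (n : ℤ) - 1 := fun z hz => by
    have := (hSF hz).1; rw [mem_triStrip, h8] at this; omega
  have hSHb : ∀ z ∈ SH, t ≤ z 1 ∧ z 1 ≤ t + (n / 64 : ℕ) := fun z hz => by
    have := (hSH hz).1; rw [mem_triStrip] at this; omega
  obtain ⟨u, huH, huF⟩ := exists_mem_of_cross (L := (n : ℤ) - (n / 8 : ℕ) + 1) (R := (n : ℤ) - 1)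
    (B := t - (n / 64 : ℕ)) (T := t + (n / 64 : ℕ)) (by omega) (by omega)
    PH' (by omega) (by omega) (fun z hz _ _ => by have := hSHb z hz; omega)
    PF' (by omega) (by rw [htt]; push_cast; ring_nf; omega) (fun z hz _ _ => hSFb z hz)
  have inner : OpenVCrossThrough (sepInnerFence n ![(n : ℤ), t]) ((![(n : ℤ), t] : Site 2) 1 - (n / 64 : ℕ))
      ((![(n : ℤ), t] : Site 2) 1 + (n / 64 : ℕ)) χ u := by
    have hsub : SF ⊆ sepInnerFence n ![(n : ℤ), t] ∩ χ := fun z hz =>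
      ⟨tgtVStrip_subset_sepInnerFence (by omega) t (hSF hz).1, (hSF hz).2⟩
    refine ⟨bb, tt, ?_, ?_, (TF u huF).mono hsub, ((TF u huF).symm.trans (TF tt PF'.right_mem)).mono hsub⟩
    · rw [site_mk_apply_one, hbb]
    · rw [site_mk_apply_one, htt]; push_cast; ring
  -- (2) the exit run, read with the prescribed crossings
  obtain ⟨L₀, hL₀⟩ := vchunks_eq_cons (r : ℤ) (-(r : ℤ)) e s j₀ d
  have hchSL : List.IsChain Crosses (vPiece r (-(r : ℤ)) e s j₀ :: L₀) := hL₀ ▸ isChain_vchunks _ _ e s j₀ (d + 1)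
  have hmemSL : ∀ T ∈ vPiece r (-(r : ℤ)) e s j₀ :: L₀, T ∈ vchunks r (-(r : ℤ)) e s j₀ (d + 1) := fun T hT => hL₀ ▸ hT
  have runs := chain_paths' X Y (vPiece r (-(r : ℤ)) e s j₀) L₀ hchSL (fun T hT => hXY T (hSL T (hmemSL T hT)))
  have hlast : vPiece r (-(r : ℤ)) e s (j₀ + d) ∈ vPiece r (-(r : ℤ)) e s j₀ :: L₀ := by
    rw [← hL₀]; exact List.mem_of_mem_getLast? (by rw [getLast?_vchunks]; rfl)
  have PV := runs _ hlast
  obtain ⟨SV, hSV, PV', TV⟩ := PV.exists_support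
  have hX0 : X (vPiece r (-(r : ℤ)) e s j₀) 1 = -(r : ℤ) + j₀ * s - e := by
    have := (hXY _ (hSL _ (hmemSL _ List.mem_cons_self))).1
    exact this.1.trans (by simp only [vPiece])
  have hX1 : X (vPiece r (-(r : ℤ)) e s (j₀ + d)) 1 = -(r : ℤ) + (j₀ + d) * s - e := by
    have := (hXY _ (hSL _ (hmemSL _ hlast))).1
    exact this.1.trans (by simp only [vPiece, Nat.cast_add])
  have hSVb : ∀ z ∈ SV, (r : ℤ) - e ≤ z 0 ∧ z 0 ≤ (r : ℤ) + e := fun z hz => by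
    obtain ⟨⟨T, hT, hzT⟩, -⟩ := hSV hz
    have := bounds_of_mem_vchunks (r : ℤ) (-(r : ℤ)) e s (hmemSL T hT) hzT
    exact ⟨this.1, this.2.1⟩
  obtain ⟨v, hvH, hvV⟩ := exists_mem_of_cross (L := (r : ℤ) - e) (R := (r : ℤ) + e) (B := t) (T := t + (n / 64 : ℕ))
    (by omega) (by omega) PH' (by omega) (by rw [hhr]; omega) (fun z hz _ _ => hSHb z hz)
    PV' (by rw [hX0]; exact hlo) (by rw [hX1]; exact hhi) (fun z hz _ _ => hSVb z hz)
  -- (3) along the arc to the entry tube, then to the arm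
  have PA := (chain_paths' X Y E L hch hXY Te hTe).symm.trans (chain_paths' X Y E L hch hXY _ (hSL _ (hmemSL _ List.mem_cons_self)))
  -- (4) assemble inside the arm region
  set R : Set (Site 2) := sepJoinRegion n N zo ![(n : ℤ), t] with hR
  have hHreg : SH ⊆ R ∩ χ := fun z hz =>
    ⟨tgtHStrip_subset_sepJoinRegion hn (by omega) (by omega) ⟨by omega, by omega⟩ zo (hSH hz).1, (hSH hz).2⟩
  have hann : triAnnulusSet n N ⊆ R := fun z hz => Or.inl (Or.inl hz)
  have hVreg : SV ⊆ R ∩ χ := fun z hz => by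
    obtain ⟨⟨T, hT, hzT⟩, hzχ⟩ := hSV hz
    exact ⟨hann (hLreg T (hSL T (hmemSL T hT)) hzT), hzχ⟩
  have hAreg : boxAll (E :: L) ∩ χ ⊆ R ∩ χ := by
    rintro z ⟨⟨T, hT, hzT⟩, hzχ⟩; exact ⟨hann (hLreg T hT hzT), hzχ⟩
  have Q1 : PathIn triGraph (R ∩ χ) u hl := (TH u huH).symm.mono hHreg
  have Q2 : PathIn triGraph (R ∩ χ) hl v := (TH v hvH).mono hHreg
  have Q3 : PathIn triGraph (R ∩ χ) v (X (vPiece r (-(r : ℤ)) e s j₀)) := (TV v hvV).symm.mono hVreg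
  have Q4 : PathIn triGraph (R ∩ χ) (X (vPiece r (-(r : ℤ)) e s j₀)) (X Te) := PA.symm.mono hAreg
  have Q5 : PathIn triGraph (R ∩ χ) (X Te) uo := P₁.symm.mono fun z hz => ⟨hR₁ hz.1, hz.2⟩
  exact ⟨zo, ![(n : ℤ), t], u, uo, hzo, ht, inner, hOut, (((Q1.trans Q2).trans Q3).trans Q4).trans Q5⟩

end Literature.Probability.Percolation
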